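import Mathlib.NumberTheory.NumberField.CMField
import Mathlib.LinearAlgebra.Matrix.GeneralLinearGroup.Defs
import Mathlib.LinearAlgebra.Matrix.PosDef
import Mathlib.Analysis.Calculus.FDeriv.Basic
import Mathlib.Topology.Instances.Matrix
import Literature.NumberTheory.Transcendental.Analytification
import HarnessLib

/-!
# Compact arithmetic quotients of the complex ball: the datum `X(ℂ) ≅ Γ \ 𝔹ᵖ`

Bergeron–Millson–Moeglin (BMM), *The Hodge conjecture and arithmetic quotients of complex balls*,
Acta Math. 216 (2016) = arXiv:1306.1515, Introduction §1.1 and Part 2 §§1.1–1.4: `E` is a CM field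
with maximal totally real subfield `F`; `V` a non-degenerate ANISOTROPIC hermitian `E`-space of
dimension `p + 1`, of signature `(p,1)` at one complex embedding `τ₁` (up to conjugation) and
positive definite at the others; `Γ = G(ℚ) ∩ K ⊂ U(V)(F)` a torsion-free congruence subgroup
(`K ⊂ G(𝔸_f)` compact open, `G = Res_{F/ℚ} U(V)`); `S(Γ) = Γ \ 𝔹`, `𝔹` the ball of negative lines of
`V ⊗_{E,τ₁} ℂ` (`≅` the unit ball of `ℂᵖ`), "is a projective complex manifold" (§1.2).

`UnitaryBallQuotientDatum p X` (= `UnitaryBallUniformisationDatum p X`, the uniformisation data, extended by the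
four special-cycle fields) bundles such data for a `ℂ`-scheme `X : Motives.SchemeOver ℂ` with
an identification of `X(ℂ)` (analytic topology, `Motives.ComplexPoints`) with `Γ \ 𝔹` compatible with
the complex structures. It is a HYPOTHESIS structure (requested by route
`HodgeConjecture/EndoscopicBallQuotient`, consumed as `∀ D : …` / `Nonempty …`); EXISTENCE of data
(Kottwitz, Clozel) is a separate theorem and is not asserted here. Rendering:

* `E : Subfield ℂ`, a number field with `NumberField.IsCMField E`; `τ₁ = E.subtype` (BMM identify
  `E ⊂ ℂ` via `τ₁`); `σ = conjRingHom E` is Mathlib's `IsCMField.complexConj`; `F = E⁺` is implicit.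
* `V = E^{p+1}` with Gram matrix `H`, `hermForm σ H u v = Σ σ(uᵢ) Hᵢⱼ vⱼ`; hermitian, anisotropic,
  signature `(p,1)` at `τ₁` in Sylvester form (`Tᴴ H^{τ₁} T = diag(1,…,1,-1)`, BMM Part 2 §1.1:
  "choosing a suitable isomorphism `V_τ ≅ ℂᵐ` we may write `(u,v) = ᵗū H_{p,q} v`") and
  `Matrix.PosDef (H.map τ)` (Mathlib, scoped `ComplexOrder`) at every `τ` off the place of `τ₁`.
* `U(V)(F) = unitaryGroup σ H ≤ GL_{p+1}(E)`. CONGRUENCE subgroup (`IsCongruenceSubgroup`): contains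
  a principal congruence subgroup `Γ(n) = {g ∈ U(V)(F) ∩ GL_{p+1}(𝓞_E) | g ≡ 1 mod n}`, `n ≥ 1`, with
  finite index — equivalent to `Γ = U(V)(F) ∩ K`, `K` compact open: the `K(n)` form a basis of
  neighbourhoods of `1`, a compact open `K` is a finite union of `K(n)`-cosets, and conversely such a
  `Γ` stabilises the lattice `L' = Σ_{γ ∈ Γ/(Γ ∩ U(L))} γL` and equals `U(V)(F) ∩ Γ·K_{L'}(n')`.
  `torsionFree` is explicit (BMM take `K` neat, whence `Γ` torsion free, Part 2 §1.4).
* The ball is presented by the open NEGATIVE CONE `negCone H^{τ₁} ⊂ ℂ^{p+1}` (`𝔹 = negCone/ℂˣ`,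
  BMM Part 2 §1.3: the space of negative lines). The uniformization `unif : ℂ^{p+1} → X(ℂ)` (junk
  off the cone) is continuous and open on the cone, onto, constant exactly on `Γ·ℂˣ`-orbits — so
  `Γ \ 𝔹 ≃ₜ X(ℂ)` (`UnitaryBallUniformisationDatum.homeomorph`, PROVED) — and HOLOMORPHIC in algebraic
  coordinates (regular functions on affine opens pull back to holomorphic functions on the cone, the
  clause of the tree's `IsAnalytification`); as `X` is smooth projective of dimension `p` (field
  `isSmoothProjective`), `Γ \ 𝔹 → X^an` is then a bijective holomorphic map of `p`-dimensional complex
  manifolds, i.e. a biholomorphism.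
* Special cycles (BMM §1.7, Part 2 §§3.2–3.3): for a totally positive definite `E`-subspace `W ⊆ V`,
  the sub-ball `𝔹(W^⊥)` maps onto the connected cycle `c(W)`, image of `Γ_W \ 𝔹(W^⊥)` (a Shimura
  subvariety for `U(W^⊥) ≅ U(p - dim W, 1)`), a closed algebraic subvariety of codimension `dim W`.
  The structure records it on the SCHEME side: `specialSubvariety W : Set X.left`, Zariski closed,
  complex points = image of the sub-cone, points of codimension `≥ dim W` (so that classes supported
  on special cycles are `HodgeTheory.supportedClasses`-style kernels).

Every field beyond the algebraic data is a property of the genuine `S(Γ)`; recording it makes the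
structure harder to inhabit, never easier. NOT here: existence; the adelic `Sh_K(G,X)`; Hecke
correspondences; Kudla's weighted cycles; a `ChartedSpace` structure on `Γ \ 𝔹`.

## References

* [BergeronMillsonMoeglin2016Balls] N. Bergeron, J. Millson, C. Moeglin, Acta Math. 216 (2016),
  arXiv:1306.1515: Introduction §§1.1–1.3, 1.7; Part 2 §§1.1–1.4, 3.2–3.4.
-/

noncomputable section

open Matrix NumberField Topology
open scoped ComplexOrder

namespace Literature.AlgebraicGeometry.ShimuraVarieties

open Literature.AlgebraicGeometry.Motives (SchemeOver ComplexPoints IsSmoothProjective AlgPoints)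

universe u

/-! ### Hermitian forms given by a Gram matrix, unitary and congruence groups -/

section Hermitian

variable {R : Type u} [CommRing R] {m : Type*} [Fintype m]

/-- The sesquilinear form with Gram matrix `H` for the involution `σ`:
`⟪u, v⟫ = Σᵢⱼ σ(uᵢ) Hᵢⱼ vⱼ = (σ ∘ u) ⬝ᵥ (H *ᵥ v)`, conjugate-linear in the FIRST variable (BMM take
it conjugate-linear in the second; the unitary group and the ball do not depend on this choice).
[cite: BergeronMillsonMoeglin2016Balls, Part 2 §1.1] -/
def hermForm (σ : R →+* R) (H : Matrix m m R) (u v : m → R) : R :=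
  (σ ∘ u) ⬝ᵥ (H *ᵥ v)

/-- Over `ℂ` with complex conjugation, `hermForm` is `star u ⬝ᵥ (H *ᵥ v)` (the form used by
Mathlib's `Matrix.PosDef`). [folklore] -/
theorem hermForm_starRingEnd (H : Matrix m m ℂ) (u v : m → ℂ) :
    hermForm (starRingEnd ℂ) H u v = star u ⬝ᵥ (H *ᵥ v) := rfl

/-- A ring homomorphism `τ` intertwining the involutions (`τ ∘ σ = conj ∘ τ`) carries the form with
Gram matrix `H` to the complex hermitian form with Gram matrix `H.map τ`: `τ ⟪u,v⟫_H = ⟪τu, τv⟫_{H^τ}`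
(the completion `V_τ = V ⊗_{E,τ} ℂ`, BMM Part 2 §1.1). [cite: BergeronMillsonMoeglin2016Balls, Part 2 §1.1] -/
theorem map_hermForm {σ : R →+* R} (τ : R →+* ℂ) (hτ : ∀ x, τ (σ x) = starRingEnd ℂ (τ x))
    (H : Matrix m m R) (u v : m → R) :
    τ (hermForm σ H u v) = hermForm (starRingEnd ℂ) (H.map τ) (τ ∘ u) (τ ∘ v) := by
  simp only [hermForm, dotProduct, mulVec, Function.comp_apply, map_sum, map_mul, hτ,
    Matrix.map_apply, Finset.mul_sum]

variable [DecidableEq m]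

/-- The **unitary group** `U(H)(R)` of the form with Gram matrix `H`: the invertible matrices `g`
with `(σg)ᵀ H g = H`, i.e. `⟪g u, g v⟫ = ⟪u, v⟫` — for `R = E` a CM field this is the group
`G₁(ℚ) = U(V)(F)` of `E`-linear isometries (BMM Part 2 §1.2). [cite: BergeronMillsonMoeglin2016Balls, Part 2 §1.2] -/
def unitaryGroup (σ : R →+* R) (H : Matrix m m R) : Subgroup (GL m R) where
  carrier := {g | ((g : Matrix m m R).map σ)ᵀ * H * (g : Matrix m m R) = H}
  one_mem' := by
    simp only [Set.mem_setOf_eq, Units.val_one, Matrix.map_one σ (map_zero σ) (map_one σ),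
      transpose_one, Matrix.one_mul, Matrix.mul_one]
  mul_mem' {g h} hg hh := by
    simp only [Set.mem_setOf_eq, Units.val_mul] at hg hh ⊢
    calc (((g : Matrix m m R) * h).map σ)ᵀ * H * ((g : Matrix m m R) * h)
        = ((h : Matrix m m R).map σ)ᵀ * ((((g : Matrix m m R)).map σ)ᵀ * H * g) * h := by
          rw [Matrix.map_mul, transpose_mul]; simp only [Matrix.mul_assoc]
      _ = H := by rw [hg, hh]
  inv_mem' {g} hg := by
    simp only [Set.mem_setOf_eq] at hg ⊢
    calc (((g⁻¹ : GL m R) : Matrix m m R).map σ)ᵀ * H * ((g⁻¹ : GL m R) : Matrix m m R)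
        = (((g⁻¹ : GL m R) : Matrix m m R).map σ)ᵀ * ((((g : Matrix m m R)).map σ)ᵀ * H * g) *
            ((g⁻¹ : GL m R) : Matrix m m R) := by rw [hg]
      _ = (((g : Matrix m m R) * ((g⁻¹ : GL m R) : Matrix m m R)).map σ)ᵀ * H *
            ((g : Matrix m m R) * ((g⁻¹ : GL m R) : Matrix m m R)) := by
          rw [Matrix.map_mul, transpose_mul]; simp only [Matrix.mul_assoc]
      _ = H := by
          rw [Units.mul_inv, Matrix.map_one σ (map_zero σ) (map_one σ), transpose_one,
            Matrix.one_mul, Matrix.mul_one]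

/-- Membership in the unitary group is the matrix identity `(σg)ᵀ H g = H`. [cite: BergeronMillsonMoeglin2016Balls, Part 2 §1.2] -/
theorem mem_unitaryGroup_iff {σ : R →+* R} {H : Matrix m m R} {g : GL m R} :
    g ∈ unitaryGroup σ H ↔ ((g : Matrix m m R).map σ)ᵀ * H * (g : Matrix m m R) = H :=
  Iff.rfl

end Hermitian

section Congruence

variable {E : Type*} [Field E] {m : Type*} [Fintype m] [DecidableEq m]

/-- `g ≡ 1 (mod n)` integrally: `g = 1 + n·A` for a matrix `A` with entries in the ring of integers
`𝓞_E` (so in particular `g` preserves the standard lattice `𝓞_E^m`). [folklore] -/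
def IsCongruentOneMod (n : ℕ) (g : Matrix m m E) : Prop :=
  ∃ A : Matrix m m (𝓞 E), g = 1 + n • A.map (algebraMap (𝓞 E) E)

omit [Fintype m] in
/-- `1 ≡ 1 (mod n)`. [folklore] -/
theorem isCongruentOneMod_one (n : ℕ) : IsCongruentOneMod n (1 : Matrix m m E) :=
  ⟨0, by rw [Matrix.map_zero _ (map_zero _), smul_zero, add_zero]⟩

/-- Products of matrices `≡ 1 (mod n)` are `≡ 1 (mod n)`: `(1 + nA)(1 + nB) = 1 + n(A + B + nAB)`.
[folklore] -/
theorem IsCongruentOneMod.mul {n : ℕ} {g h : Matrix m m E} (hg : IsCongruentOneMod n g)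
    (hh : IsCongruentOneMod n h) : IsCongruentOneMod n (g * h) := by
  obtain ⟨A, rfl⟩ := hg
  obtain ⟨B, rfl⟩ := hh
  refine ⟨A + B + n • (A * B), ?_⟩
  have hmap : (A + B + n • (A * B)).map (algebraMap (𝓞 E) E) =
      A.map (algebraMap (𝓞 E) E) + B.map (algebraMap (𝓞 E) E) +
        n • (A.map (algebraMap (𝓞 E) E) * B.map (algebraMap (𝓞 E) E)) := by
    rw [← Matrix.map_mul]
    change (algebraMap (𝓞 E) E).mapMatrix (A + B + n • (A * B)) = _
    rw [map_add, map_add, map_nsmul]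
    rfl
  rw [hmap]
  simp only [add_mul, mul_add, Matrix.one_mul, Matrix.mul_one, smul_mul_assoc, mul_smul_comm,
    smul_add]
  abel

/-- The **principal congruence subgroup** of level `n` of `U(H)(E)` for the standard lattice `𝓞_E^m`:
the `g ∈ U(H)` with `g ≡ 1` and `g⁻¹ ≡ 1 (mod n)` integrally; it is `U(V)(F) ∩ K(n)` for the
compact open `K(n) ⊂ U(V)(𝔸_{F,f})` fixing `𝓞_E^m ⊗ Ẑ` and trivial mod `n` (BMM Introduction §1.1:
"`Γ = G(ℚ) ∩ K`"). [cite: BergeronMillsonMoeglin2016Balls, Introduction §1.1] -/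
def principalCongruenceSubgroup (σ : E →+* E) (H : Matrix m m E) (n : ℕ) : Subgroup (GL m E) where
  carrier := {g | g ∈ unitaryGroup σ H ∧ IsCongruentOneMod n (g : Matrix m m E) ∧
    IsCongruentOneMod n ((g⁻¹ : GL m E) : Matrix m m E)}
  one_mem' := ⟨one_mem _, by simpa using isCongruentOneMod_one n,
    by simpa using isCongruentOneMod_one n⟩
  mul_mem' {g h} hg hh := ⟨mul_mem hg.1 hh.1, by simpa using hg.2.1.mul hh.2.1,
    by simpa [_root_.mul_inv_rev] using hh.2.2.mul hg.2.2⟩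
  inv_mem' {g} hg := ⟨inv_mem hg.1, hg.2.2, by simpa using hg.2.1⟩

/-- `Γ ≤ GL_m(E)` is a **congruence subgroup** of `U(H)(E) = U(V)(F)`: it consists of isometries and
contains a principal congruence subgroup `Γ(n)`, `n ≥ 1`, with finite index; equivalently
`Γ = U(V)(F) ∩ K` for a compact open `K ⊂ U(V)(𝔸_{F,f})` (module docstring).
[cite: BergeronMillsonMoeglin2016Balls, Introduction §1.1] -/
def IsCongruenceSubgroup (σ : E →+* E) (H : Matrix m m E) (Γ : Subgroup (GL m E)) : Prop :=
  Γ ≤ unitaryGroup σ H ∧ ∃ n : ℕ, 0 < n ∧ principalCongruenceSubgroup σ H n ≤ Γ ∧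
    ((principalCongruenceSubgroup σ H n).subgroupOf Γ).FiniteIndex

/-- An `E`-subspace `W ⊆ E^m` is **totally positive definite** for the form with Gram matrix `H`:
`⟪w, w⟫ > 0` at every complex embedding of `E`, for every `w ∈ W ∖ {0}` (the "totally positive
Hermitian subspaces" carrying special cycles, BMM Introduction §1.7).
[cite: BergeronMillsonMoeglin2016Balls, Introduction §1.7] -/
def IsTotallyPositive (σ : E →+* E) (H : Matrix m m E) (W : Submodule E (m → E)) : Prop :=
  ∀ w ∈ W, w ≠ 0 → ∀ τ : E →+* ℂ, 0 < (τ (hermForm σ H w w)).re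

end Congruence

/-! ### The ball of negative lines, as the negative cone in `ℂᵐ` -/

section Ball

variable {m : Type*} [Fintype m]

/-- The open **negative cone** `{v ∈ ℂᵐ | ⟪v, v⟫ < 0}` of the complex hermitian form with Gram matrix
`Hc`; for `Hc` of signature `(p, 1)` its image in `ℙ(ℂ^{p+1})` is the ball `𝔹 ≅ U(p,1)/(U(p) × U(1))`
of negative lines (BMM Part 2 §1.3: "`X` … is the space of negative `q`-planes in `V_{τ₁}`").
[cite: BergeronMillsonMoeglin2016Balls, Part 2 §1.3] -/
def negCone (Hc : Matrix m m ℂ) : Set (m → ℂ) :=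
  {v | (hermForm (starRingEnd ℂ) Hc v v).re < 0}

/-- Membership in the negative cone. [cite: BergeronMillsonMoeglin2016Balls, Part 2 §1.3] -/
theorem mem_negCone_iff {Hc : Matrix m m ℂ} {v : m → ℂ} :
    v ∈ negCone Hc ↔ (star v ⬝ᵥ (Hc *ᵥ v)).re < 0 :=
  Iff.rfl

/-- The negative cone is open. [folklore] -/
theorem isOpen_negCone (Hc : Matrix m m ℂ) : IsOpen (negCone Hc) :=
  isOpen_lt (Complex.continuous_re.comp
    ((continuous_pi fun i ↦ (continuous_apply i).star).dotProduct
      (continuous_const.matrix_mulVec continuous_id))) continuous_const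

/-- `⟪c • u, c • v⟫ = conj c * c * ⟪u, v⟫`. [folklore] -/
theorem hermForm_smul_smul (Hc : Matrix m m ℂ) (c : ℂ) (u v : m → ℂ) :
    hermForm (starRingEnd ℂ) Hc (c • u) (c • v) =
      starRingEnd ℂ c * c * hermForm (starRingEnd ℂ) Hc u v := by
  rw [hermForm_starRingEnd, hermForm_starRingEnd, star_smul, mulVec_smul, dotProduct_smul,
    smul_dotProduct, smul_eq_mul, smul_eq_mul, Complex.star_def]
  ring

/-- The negative cone is stable under non-zero scalars: it is a union of punctured lines.
[cite: BergeronMillsonMoeglin2016Balls, Part 2 §1.3] -/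
theorem smul_mem_negCone {Hc : Matrix m m ℂ} {c : ℂ} (hc : c ≠ 0) {v : m → ℂ}
    (hv : v ∈ negCone Hc) : c • v ∈ negCone Hc := by
  simp only [negCone, Set.mem_setOf_eq] at hv ⊢
  rw [hermForm_smul_smul, ← Complex.normSq_eq_conj_mul_self, Complex.re_ofReal_mul]
  exact mul_neg_of_pos_of_neg (Complex.normSq_pos.2 hc) hv

/-- The **sub-cone** of vectors of the negative cone orthogonal to a set `S ⊆ ℂᵐ`; for `S = τ₁(W)`,
`W ⊆ V` totally positive, its image in the ball is the sub-ball `𝔹(W^⊥)` uniformizing the special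
cycle attached to `W` (BMM Part 2 §3.3). [cite: BergeronMillsonMoeglin2016Balls, Part 2 §3.3] -/
def subCone (Hc : Matrix m m ℂ) (S : Set (m → ℂ)) : Set (m → ℂ) :=
  negCone Hc ∩ {v | ∀ w ∈ S, hermForm (starRingEnd ℂ) Hc w v = 0}

/-- The standard Gram matrix `H_{p,1} = diag(1, …, 1, -1)` of signature `(p, 1)` (BMM Part 2 §1.1).
[cite: BergeronMillsonMoeglin2016Balls, Part 2 §1.1] -/
def signatureMatrix (p : ℕ) : Matrix (Fin (p + 1)) (Fin (p + 1)) ℂ :=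
  Matrix.diagonal fun i ↦ if i = Fin.last p then -1 else 1

end Ball

/-! ### The datum -/

section Datum

/-- The complex conjugation of a CM subfield `E ⊆ ℂ` as a ring endomorphism (Mathlib's
`NumberField.IsCMField.complexConj`, the non-trivial automorphism of `E / E⁺`). [folklore] -/
def conjRingHom (E : Subfield ℂ) [NumberField E] [IsCMField E] : E →+* E :=
  (IsCMField.complexConj E).toRingEquiv.toRingHom

/-- `conjRingHom` is Mathlib's `complexConj`. [folklore] -/
@[simp]
theorem conjRingHom_apply (E : Subfield ℂ) [NumberField E] [IsCMField E] (x : E) :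
    conjRingHom E x = IsCMField.complexConj E x := rfl

/-- Every complex embedding intertwines `conjRingHom` with complex conjugation
(`IsCMField.complexEmbedding_complexConj`). [folklore] -/
theorem embedding_conjRingHom (E : Subfield ℂ) [NumberField E] [IsCMField E] (τ : E →+* ℂ) (x : E) :
    τ (conjRingHom E x) = starRingEnd ℂ (τ x) :=
  IsCMField.complexEmbedding_complexConj E τ x

/-- **Uniformisation datum exhibiting the complex variety `X` as a compact arithmetic quotient of the
complex `p`-ball** (BMM Introduction §1.1, Part 2 §§1.1–1.4): a CM number field `E ⊆ ℂ` (inclusion `= τ₁`); an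
anisotropic hermitian Gram matrix `H` on `V = E^{p+1}` of signature `(p,1)` at `τ₁` and positive definite at all
other places; a torsion-free congruence subgroup `Γ ⊆ U(V)(F)`; a uniformization `unif` of `X(ℂ)` by the negative
cone of `V_{τ₁}`: continuous, open, onto, constant exactly on `Γ·ℂˣ`-orbits (so `X(ℂ) ≃ₜ Γ \ 𝔹`,
`UnitaryBallUniformisationDatum.homeomorph`) and holomorphic in algebraic coordinates, `X` smooth projective of
dimension `p`. These are exactly the fields of `UnitaryBallQuotientDatum` below OTHER than its four special-cycle
fields: every construction of the tree that does not read special cycles (automorphic forms on the ball, theta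
lifts, Petersson products, class maps, level structures, …) is stated over this parent structure, and applies to a
`D : UnitaryBallQuotientDatum p X` through the projection `D.toUnitaryBallUniformisationDatum` (inserted by dot
notation). Existence of such data is NOT asserted. [cite: BergeronMillsonMoeglin2016Balls, Introduction §1.1 and Part 2 §§1.1–1.4] -/
structure UnitaryBallUniformisationDatum (p : ℕ) (X : SchemeOver ℂ) where
  /-- The CM field `E`, embedded in `ℂ` by `τ₁`. -/
  E : Subfield ℂ
  /-- `E` is a number field. -/
  [isNumberField : NumberField E]
  /-- `E` is CM: a totally complex quadratic extension of its maximal totally real subfield `F = E⁺`. -/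
  [isCMField : IsCMField E]
  /-- The Gram matrix of the hermitian form on `V = E^{p+1}`. -/
  H : Matrix (Fin (p + 1)) (Fin (p + 1)) E
  /-- `H` is hermitian: `σ(Hᵢⱼ) = Hⱼᵢ`. -/
  conj_H_apply : ∀ i j, conjRingHom E (H i j) = H j i
  /-- The form is anisotropic over `E`: `⟪v, v⟫ = 0 → v = 0`. -/
  anisotropic : ∀ v : Fin (p + 1) → E, hermForm (conjRingHom E) H v v = 0 → v = 0
  /-- Signature `(p, 1)` at `τ₁`: `Tᴴ H^{τ₁} T = diag(1,…,1,-1)` for some `T ∈ GL_{p+1}(ℂ)`. -/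
  signature_τ₁ : ∃ T : GL (Fin (p + 1)) ℂ,
    (T : Matrix _ _ ℂ)ᴴ * H.map E.subtype * (T : Matrix _ _ ℂ) = signatureMatrix p
  /-- Positive definite at every complex embedding not defining the place of `τ₁`. -/
  posDef_of_ne : ∀ τ : E →+* ℂ, InfinitePlace.mk τ ≠ InfinitePlace.mk E.subtype → (H.map τ).PosDef
  /-- The arithmetic group `Γ ≤ GL_{p+1}(E)`. -/
  Γ : Subgroup (GL (Fin (p + 1)) E)
  /-- `Γ` is a congruence subgroup of `U(V)(F)`. -/
  isCongruenceSubgroup : IsCongruenceSubgroup (conjRingHom E) H Γ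
  /-- `Γ` is torsion free. -/
  torsionFree : ∀ γ ∈ Γ, IsOfFinOrder γ → γ = 1
  /-- The uniformization `𝔹 → X(ℂ)`, as a function on `ℂ^{p+1}` (meaningful on the negative cone only). -/
  unif : (Fin (p + 1) → ℂ) → ComplexPoints X
  /-- `unif` is continuous on the negative cone (analytic topology on `X(ℂ)`). -/
  continuousOn_unif : ContinuousOn unif (negCone (H.map E.subtype))
  /-- `unif` is open on the negative cone. -/
  isOpenMap_unif : IsOpenMap ((negCone (H.map E.subtype)).restrict unif)
  /-- `unif` maps the negative cone onto `X(ℂ)`. -/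
  surjOn_unif : Set.SurjOn unif (negCone (H.map E.subtype)) Set.univ
  /-- The fibres of `unif` on the cone are exactly the `Γ·ℂˣ`-orbits: `X(ℂ) = Γ \ 𝔹` as a set. -/
  unif_eq_unif_iff : ∀ v ∈ negCone (H.map E.subtype), ∀ w ∈ negCone (H.map E.subtype),
    unif v = unif w ↔ ∃ γ ∈ Γ, ∃ c : ℂ, c ≠ 0 ∧
      ((γ : Matrix _ _ E).map E.subtype) *ᵥ v = c • w
  /-- `unif` is holomorphic: regular functions on affine opens of `X` pull back to holomorphic
  functions on the (open) part of the cone above them. -/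
  differentiableOn_unif : ∀ (U : X.left.affineOpens)
    (s : X.left.presheaf.obj (Opposite.op (↑U : X.left.Opens))),
    DifferentiableOn ℂ (fun v ↦ AlgPoints.evalOrZero (↑U : X.left.Opens) s (unif v))
      (negCone (H.map E.subtype) ∩ unif ⁻¹' {P | P.pt ∈ (↑U : X.left.Opens)})
  /-- `X` is a smooth projective variety of dimension `p` over `ℂ`. -/
  isSmoothProjective : IsSmoothProjective p X

-- Bundled-instance projections (Mathlib pattern, cf. `ModuleCat.isModule`); they fire only on `↥D.E` (parent and child alike).
attribute [instance] UnitaryBallUniformisationDatum.isNumberField UnitaryBallUniformisationDatum.isCMField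

/-- **Datum exhibiting the complex variety `X` as a compact connected Shimura variety of simple
unitary type uniformized by the complex `p`-ball** (BMM Introduction §1.1, Part 2 §§1.1–1.4): a CM
number field `E ⊆ ℂ` (inclusion `= τ₁`); an anisotropic hermitian Gram matrix `H` on `V = E^{p+1}` of
signature `(p,1)` at `τ₁` and positive definite at all other places; a torsion-free congruence
subgroup `Γ ⊆ U(V)(F)`; a uniformization `unif` of `X(ℂ)` by the negative cone of `V_{τ₁}`:
continuous, open, onto, constant exactly on `Γ·ℂˣ`-orbits (so `X(ℂ) ≃ₜ Γ \ 𝔹`,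
`UnitaryBallUniformisationDatum.homeomorph`) and holomorphic in algebraic coordinates (so `X^an ≅ Γ \ 𝔹` as
complex manifolds, `X` being smooth projective of dimension `p`); and, for each totally positive
definite `W ⊆ V`, the special subvariety of `X` whose complex points are the image of the sub-ball
`𝔹(W^⊥)`: Zariski closed, of codimension `≥ dim W` (BMM §1.7, Part 2 §§3.2–3.3). Existence of such
data is NOT asserted. [cite: BergeronMillsonMoeglin2016Balls, Introduction §1.1 and Part 2 §§1.1–1.4, 3.2–3.3] -/
structure UnitaryBallQuotientDatum (p : ℕ) (X : SchemeOver ℂ) extends UnitaryBallUniformisationDatum p X where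
  /-- The special subvariety of `X` attached to an `E`-subspace `W ⊆ V` (meaningful for `W` totally
  positive definite only; junk otherwise). -/
  specialSubvariety : Submodule E (Fin (p + 1) → E) → Set X.left
  /-- Special subvarieties are Zariski closed. -/
  isClosed_specialSubvariety : ∀ W, IsTotallyPositive (conjRingHom E) H W →
    IsClosed (specialSubvariety W)
  /-- The complex points of the special subvariety of `W` are the images of the sub-cone `W^⊥ ∩ cone`. -/
  pt_mem_specialSubvariety_iff : ∀ W, IsTotallyPositive (conjRingHom E) H W →
    ∀ P : ComplexPoints X, P.pt ∈ specialSubvariety W ↔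
      P ∈ unif '' subCone (H.map E.subtype) ((fun w ↦ E.subtype ∘ w) '' (W : Set (Fin (p + 1) → E)))
  /-- The special subvariety of `W` has codimension `≥ dim_E W` at each of its points. -/
  le_coheight_of_mem_specialSubvariety : ∀ W, IsTotallyPositive (conjRingHom E) H W →
    ∀ z ∈ specialSubvariety W, (Module.finrank E W : ℕ∞) ≤ Order.coheight z

end Datum

namespace UnitaryBallUniformisationDatum

variable {p : ℕ} {X : SchemeOver ℂ} (D : UnitaryBallUniformisationDatum p X)

/-- The distinguished complex embedding `τ₁ : E → ℂ` (the inclusion). [cite: BergeronMillsonMoeglin2016Balls, Part 2 §1.1] -/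
abbrev τ₁ : D.E →+* ℂ := D.E.subtype

/-- The Gram matrix of the complex hermitian space `V_{τ₁} = V ⊗_{E,τ₁} ℂ` of signature `(p,1)`.
[cite: BergeronMillsonMoeglin2016Balls, Part 2 §1.1] -/
abbrev Hℂ : Matrix (Fin (p + 1)) (Fin (p + 1)) ℂ := D.H.map D.τ₁

/-- The negative cone of `V_{τ₁}`, whose projectivization is the ball `𝔹` uniformizing `X(ℂ)`.
[cite: BergeronMillsonMoeglin2016Balls, Part 2 §1.3] -/
abbrev cone : Set (Fin (p + 1) → ℂ) := negCone D.Hℂ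

/-- The action of `γ ∈ GL_{p+1}(E)` on `ℂ^{p+1} = V_{τ₁}` through `τ₁`. [cite: BergeronMillsonMoeglin2016Balls, Part 2 §1.2] -/
abbrev act (γ : GL (Fin (p + 1)) D.E) (v : Fin (p + 1) → ℂ) : Fin (p + 1) → ℂ :=
  ((γ : Matrix (Fin (p + 1)) (Fin (p + 1)) D.E).map D.τ₁) *ᵥ v

/-- `H^{τ₁}` is a hermitian complex matrix. [cite: BergeronMillsonMoeglin2016Balls, Part 2 §1.1] -/
theorem isHermitian_Hℂ : D.Hℂ.IsHermitian :=
  Matrix.IsHermitian.ext fun i j ↦ by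
    change star (D.τ₁ (D.H j i)) = D.τ₁ (D.H i j)
    rw [Complex.star_def, ← embedding_conjRingHom, D.conj_H_apply]

/-- Isometries act on `V_{τ₁}` preserving the complex form: `(γ^{τ₁})ᴴ H^{τ₁} γ^{τ₁} = H^{τ₁}` for
`γ ∈ U(V)(F)` (apply `τ₁` to `(σγ)ᵀ H γ = H`; `τ₁ ∘ σ = conj ∘ τ₁`). [cite: BergeronMillsonMoeglin2016Balls, Part 2 §1.2] -/
theorem conjTranspose_mul_Hℂ_mul {γ : GL (Fin (p + 1)) D.E}
    (hγ : γ ∈ unitaryGroup (conjRingHom D.E) D.H) :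
    ((γ : Matrix (Fin (p + 1)) (Fin (p + 1)) D.E).map D.τ₁)ᴴ * D.Hℂ *
      (γ : Matrix (Fin (p + 1)) (Fin (p + 1)) D.E).map D.τ₁ = D.Hℂ := by
  have h := congrArg (fun M : Matrix (Fin (p + 1)) (Fin (p + 1)) D.E ↦ M.map D.τ₁)
    (mem_unitaryGroup_iff.1 hγ)
  simp only [Matrix.map_mul] at h
  have ht : (((γ : Matrix (Fin (p + 1)) (Fin (p + 1)) D.E).map (conjRingHom D.E))ᵀ).map D.τ₁ =
      ((γ : Matrix (Fin (p + 1)) (Fin (p + 1)) D.E).map D.τ₁)ᴴ := by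
    ext i j
    simp only [Matrix.map_apply, transpose_apply, conjTranspose_apply, Complex.star_def,
      embedding_conjRingHom]
  rwa [ht] at h

/-- `Γ` preserves the negative cone (it acts on the ball `𝔹`). [cite: BergeronMillsonMoeglin2016Balls, Part 2 §1.3] -/
theorem act_mem_cone {γ : GL (Fin (p + 1)) D.E} (hγ : γ ∈ D.Γ) {v : Fin (p + 1) → ℂ}
    (hv : v ∈ D.cone) : D.act γ v ∈ D.cone := by
  have hu := D.conjTranspose_mul_Hℂ_mul (D.isCongruenceSubgroup.1 hγ)
  change (star ((((γ : Matrix (Fin (p + 1)) (Fin (p + 1)) D.E)).map D.τ₁) *ᵥ v) ⬝ᵥ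
    (D.Hℂ *ᵥ ((((γ : Matrix (Fin (p + 1)) (Fin (p + 1)) D.E)).map D.τ₁) *ᵥ v))).re < 0
  rw [star_mulVec, mulVec_mulVec, dotProduct_mulVec, vecMul_vecMul, ← Matrix.mul_assoc, hu,
    ← dotProduct_mulVec]
  exact hv

/-- `unif` is constant on punctured complex lines of the cone (take `γ = 1` in `unif_eq_unif_iff`):
it factors through the ball of negative lines. [cite: BergeronMillsonMoeglin2016Balls, Part 2 §1.3] -/
theorem unif_smul {c : ℂ} (hc : c ≠ 0) {v : Fin (p + 1) → ℂ} (hv : v ∈ D.cone) :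
    D.unif (c • v) = D.unif v := by
  refine (D.unif_eq_unif_iff (c • v) (smul_mem_negCone hc hv) v hv).2 ⟨1, one_mem _, c, hc, ?_⟩
  simp

/-- The orbit relation of `Γ·ℂˣ` on the negative cone (`v ∼ w ↔ unif v = unif w`), whose quotient is
`Γ \ 𝔹`. [cite: BergeronMillsonMoeglin2016Balls, Introduction §1.1] -/
def orbitSetoid : Setoid D.cone :=
  Setoid.ker (D.cone.restrict D.unif)

/-- The **ball quotient** `Γ \ 𝔹` as a topological space: the negative cone modulo `Γ·ℂˣ`, with the
quotient topology (an `abbrev`, so that `Quotient` instances apply). [cite: BergeronMillsonMoeglin2016Balls, Introduction §1.1] -/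
abbrev ballQuotient : Type := Quotient D.orbitSetoid

/-- Two cone vectors define the same point of `Γ \ 𝔹` iff they lie in the same `Γ·ℂˣ`-orbit
(field `unif_eq_unif_iff`). [cite: BergeronMillsonMoeglin2016Balls, Introduction §1.1] -/
theorem mk_eq_mk_iff (v w : D.cone) :
    (Quotient.mk D.orbitSetoid v : D.ballQuotient) = Quotient.mk _ w ↔
      ∃ γ ∈ D.Γ, ∃ c : ℂ, c ≠ 0 ∧ D.act γ v = c • (w : Fin (p + 1) → ℂ) :=
  Quotient.eq.trans (D.unif_eq_unif_iff v v.2 w w.2)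

/-- The map `Γ \ 𝔹 → X(ℂ)` induced by `unif`. [cite: BergeronMillsonMoeglin2016Balls, Introduction §1.1] -/
def lift : D.ballQuotient → ComplexPoints X :=
  Quotient.lift (D.cone.restrict D.unif) fun _ _ h ↦ h

/-- `lift` on the class of a cone vector is `unif`. [folklore] -/
@[simp]
theorem lift_mk (v : D.cone) : D.lift (Quotient.mk _ v) = D.unif v := rfl

/-- `Γ \ 𝔹 → X(ℂ)` is a bijection (fibres of `unif` are the orbits; `unif` is onto). [cite: BergeronMillsonMoeglin2016Balls, Introduction §1.1] -/
theorem bijective_lift : Function.Bijective D.lift := by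
  refine ⟨fun x y h ↦ ?_, fun P ↦ ?_⟩
  · induction x using Quotient.inductionOn
    induction y using Quotient.inductionOn
    exact Quotient.sound h
  · obtain ⟨v, hv, rfl⟩ := D.surjOn_unif (Set.mem_univ P)
    exact ⟨Quotient.mk _ ⟨v, hv⟩, rfl⟩

/-- **`X(ℂ) ≅ Γ \ 𝔹`**: the uniformization induces a homeomorphism from the ball quotient (quotient
topology) onto the complex points of `X` with the analytic topology ("`S(Γ) = Γ \ X` … `X`
identifies with the unit ball in `ℂᵖ`"). [cite: BergeronMillsonMoeglin2016Balls, Introduction §1.1] -/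
def homeomorph : D.ballQuotient ≃ₜ ComplexPoints X :=
  (Equiv.ofBijective D.lift D.bijective_lift).toHomeomorphOfContinuousOpen
    (D.continuousOn_unif.restrict.quotient_lift _)
    (fun O hO ↦ by
      have : D.lift '' O = D.cone.restrict D.unif '' (Quotient.mk _ ⁻¹' O) := by
        ext P
        constructor
        · rintro ⟨x, hx, rfl⟩
          induction x using Quotient.inductionOn with
          | h v => exact ⟨v, hx, rfl⟩
        · rintro ⟨v, hv, rfl⟩
          exact ⟨Quotient.mk _ v, hv, rfl⟩
      change IsOpen (D.lift '' O)
      rw [this]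
      exact D.isOpenMap_unif _ (hO.preimage continuous_quot_mk))

end UnitaryBallUniformisationDatum

namespace UnitaryBallQuotientDatum

-- (iib-R) The special-cycle-free declarations above live in the parent namespace
-- `UnitaryBallUniformisationDatum`; on a `D : UnitaryBallQuotientDatum p X` dot notation (`D.act`, `D.cone`,
-- `D.homeomorph`, …) reaches them through the `extends` projection. No aliases are declared here (an alias
-- `UnitaryBallQuotientDatum.act` would capture dot notation and reject the child argument).

variable {p : ℕ} {X : SchemeOver ℂ} (D : UnitaryBallQuotientDatum p X)

/-- The special subvariety of the zero subspace is all of `X`: every complex point lies on it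
(the sub-cone of `W = 0` is the whole cone and `unif` is onto). [cite: BergeronMillsonMoeglin2016Balls, Part 2 §3.3] -/
theorem pt_mem_specialSubvariety_bot (P : ComplexPoints X) : P.pt ∈ D.specialSubvariety ⊥ := by
  have h0 : IsTotallyPositive (conjRingHom D.E) D.H ⊥ := fun w hw hne ↦
    (hne ((Submodule.mem_bot _).1 hw)).elim
  rw [D.pt_mem_specialSubvariety_iff ⊥ h0 P]
  obtain ⟨v, hv, rfl⟩ := D.surjOn_unif (Set.mem_univ P)
  refine ⟨v, ⟨hv, ?_⟩, rfl⟩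
  rintro w ⟨w', hw', rfl⟩
  simp only [Submodule.bot_coe, Set.mem_singleton_iff] at hw'
  subst hw'
  simp [hermForm]

end UnitaryBallQuotientDatum

end Literature.AlgebraicGeometry.ShimuraVarieties

end
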